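import Mathlib.Analysis.Complex.Cardinality
import Mathlib.Algebra.Polynomial.Bivariate
import Literature.NumberTheory.EllipticCurves.UniformizationUniqueProofs
import Literature.NumberTheory.EllipticCurves.WeierstrassAdditionProofs
import Literature.NumberTheory.EllipticCurves.AnalyticIsogenyDescentProofs
import HarnessLib

/-!
# Algebraically dependent Weierstrass functions: the curves are `ℚ`-isogenous

Topic `Literature/NumberTheory/EllipticCurves`; a proofs-only file (theorems only: no definition,
no named fact, no statement of the tree is changed). It serves the named fact
`WeierstrassCurve.isIsogenous_iff_frobeniusTrace_eq` (`Isogeny.lean`; Faltings 1983, §5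
Korollar 2 for elliptic curves over `ℚ`) along the **Faltings-free printed proof of exactly that
statement**:

* J.-B. Bost, *Algebraic leaves of algebraic foliations over number fields*, Publ. Math. IHÉS
  **93** (2001), Corollary 2.5 (p. 173): *for any two elliptic curves `E`, `E′` over `ℚ`, `E` and
  `E′` are `ℚ`-isogenous iff `a_p(E) = a_p(E′)` for almost every prime `p`.* Bost deduces it
  from his Theorem 2.3 (a Lie subalgebra `h ⊆ Lie G` is the Lie algebra of an algebraic subgroup
  iff almost all its reductions are closed under `p`-th powers) applied to `G = E × E′` and a
  line `h ⊆ Lie E ⊕ Lie E′`: the `p`-th power map on `Lie E_{𝔽_p}` is multiplication by `a_p(E)`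
  (Hasse invariant), and — the last step — "*if `h` is algebraic, the algebraic subgroup `H` of
  `E × E′` such that `h = Lie H` is `ℚ`-isogenous both to `E` and `E′`*". (D. V. & G. V.
  Chudnovsky, Proc. Nat. Acad. Sci. USA **82** (1985), 2212–2216, prove a similar statement from
  an algebraicity criterion and Honda's theorem on formal groups; Bost, loc. cit., p. 174.)

Analytically, the leaf of `h` through the origin is `z ↦ (u₁(z), u₂(z))`, `uᵢ : ℂ → Eᵢ(ℂ)` the
uniformisations by the period lattices `Λᵢ` of the Néron differentials, and "`h` is algebraic"
says that the coordinates of the leaf are algebraically dependent: `P(℘_{Λ₁}(z), ℘_{Λ₂}(z)) = 0`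
for a non-zero polynomial `P`. **This file proves that last step in that analytic dress**:

* `exists_pos_nsmul_mem_of_evalEval_eq_zero` — the soft lemma behind it: if `f₁` is
  `Λ₁`-periodic with countable fibres, `f₂` has finitely many fibres modulo `Λ₂`, and
  `P(f₁(z), f₂(z)) = 0` off a countable set for some `P ≠ 0` in `ℂ[X][Y]`, then `mΛ₁ ⊆ Λ₂` for
  some integer `m > 0` (specialise at a generic `z₀`: the values `f₂(z₀ + ω)`, `ω ∈ Λ₁`, are roots
  of the non-zero polynomial `P(f₁(z₀), Y)`, so `Λ₁` has finite image in `ℂ/Λ₂`);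
* `exists_finite_fibre_mod_of_ker_eq`, `countable_preimage_comp_singleton_of_ker_eq`,
  `comp_apply_add_of_ker_eq` — transfer of these hypotheses along any `u : ℂ →+ E(ℂ)` with
  kernel `Λ` (a uniformisation) for a coordinate `g : E(ℂ) → ℂ` with finite fibres;
* `WeierstrassCurve.Affine.Point.finite_setOf_eq_some_X_eq`,
  `WeierstrassCurve.Affine.Point.finite_setOf_eq_some_negX_div_Y_eq` — the coordinates `x` and
  `t = -x/y` (the local parameter at `O`, *AEC* IV.1) have finite fibres on `E(F)`;
* `PeriodPair.countable_preimage_weierstrassP_singleton`,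
  `PeriodPair.exists_finite_weierstrassP_fibre_mod_lattice` — the fibres of `℘_Λ`
  (`℘(u) = ℘(v) ↔ u ± v ∈ Λ`, the tree's `PeriodPair.weierstrassP_eq_weierstrassP_iff`);
* `isIsogenous_of_evalEval_comp_eq_zero` — **the theorem, general coordinates**: for
  Weierstrass models `W₁, W₂` over `ℚ` with Néron-type period pairs `L₁, L₂`, homomorphisms
  `uᵢ : ℂ →+ Wᵢ(ℂ)` with kernel `Λᵢ` and coordinates `gᵢ` with finite fibres, a non-zero
  `P ∈ ℂ[X][Y]` with `P(g₁(u₁ z), g₂(u₂ z)) = 0` off a countable set forces `W₁ ~ W₂` over `ℚ`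
  (the form reached from an algebraicity criterion for the formal leaf `t₂ = y(t₁)`);
* `isIsogenous_of_evalEval_weierstrassP_eq_zero` — **the theorem**: for Weierstrass models
  `W₁, W₂` over `ℚ` of elliptic curves with Néron-type period pairs `L₁, L₂`
  (`g₂ = c₄/12`, `g₃ = c₆/216`), if `P(℘[L₁] z, ℘[L₂] z) = 0` off a countable set of `z` for a
  non-zero `P ∈ ℂ[X][Y]`, then `W₁` and `W₂` are isogenous **over `ℚ`** — by the soft lemma
  `mΛ₁ ⊆ Λ₂`, and a rational multiple carrying one Néron lattice into the other is a `ℚ`-isogeny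
  by the tree's `isIsogenous_of_forall_mul_mem_lattice` (`AnalyticIsogenyDescentProofs`,
  Silverman *AEC* VI.4.1, VI.5.3 with descent of the transformation polynomials).

What this leaves of Bost's proof of Corollary 2.5 for the tree: the algebraicity criterion itself
(Bost 2001, Thms. 2.1/3.4; Y. André, *Sur la conjecture des `p`-courbures de Grothendieck–Katz et
un problème de Dwork*, 2004, Thm. 5.4.3), its `p`-adic input (the Hasse invariant, Katz–Mazur
(12.4.1.2)–(12.4.1.3), or Honda's theorem on the formal group), and the identification of the
formal leaf with the analytic one (`t(uᵢ(z))` has Taylor series `exp_{Ê_i}(z)`). None of these is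
asserted here, and `isIsogenous_iff_frobeniusTrace_eq_holds` is **not** asserted (D-0026).

## References

* [Bost2001AlgebraicLeaves] J.-B. Bost, *Algebraic leaves of algebraic foliations over number
  fields*, Publ. Math. IHÉS 93 (2001), 161–221, doi:10.1007/s10240-001-8191-3 — Cor. 2.5 and its
  proof, p. 173 (held: `paper:doi-10-1007-s10240-001-8191-3`, PDF pp. 12–14 read).
* [Faltings1983Endlichkeit] G. Faltings, Invent. Math. 73 (1983), §5 Korollar 2.
* [SilvermanAEC2009] J. H. Silverman, *The Arithmetic of Elliptic Curves*, 2nd ed., GTM 106: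
  Prop. VI.3.6, Thm. VI.4.1 (`Hom(E₁, E₂) ≅ {α : αΛ₁ ⊆ Λ₂}`), Cor. VI.5.1.1, Thm. VI.5.3.

## Design

Theorems only; `noncomputable section`; the lattices of the soft lemma are `AddSubgroup ℂ`
(applied to `Lᵢ.lattice.toAddSubgroup` for Mathlib's `PeriodPair.lattice : Submodule ℤ ℂ`,
countable by the tree's `PeriodPair.countable_lattice`);
bivariate polynomials are Mathlib's `ℂ[X][Y]` with `Polynomial.evalEval x y P = P(x, y)`; the
exceptional set `D` is any countable set (in the application: the lattice points, where Mathlib's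
`℘[L]` takes the junk value `0`, or any countable set off which the relation is known).
-/

noncomputable section

open scoped Classical Polynomial.Bivariate
open Polynomial Set PeriodPair

namespace Literature.NumberTheory.EllipticCurves

/-! ### The soft lemma: algebraic dependence forces commensurability -/

section Soft

variable {Λ₁ Λ₂ : AddSubgroup ℂ} {f₁ f₂ : ℂ → ℂ}

/-- **Algebraic dependence of a `Λ₁`-periodic and a `Λ₂`-elliptic function forces `mΛ₁ ⊆ Λ₂`.**
Let `Λ₁, Λ₂ ≤ ℂ` be additive subgroups with `Λ₁` countable, `f₁ : ℂ → ℂ` a `Λ₁`-periodic function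
with countable fibres, and `f₂ : ℂ → ℂ` a function each of whose fibres meets only finitely many
cosets of `Λ₂`. If a non-zero `P ∈ ℂ[X][Y]` has `P(f₁(z), f₂(z)) = 0` for all `z` off a
countable set `D`, then `m • Λ₁ ⊆ Λ₂` for some integer `m > 0`.

Proof: pick `z₀` outside the countable set `(D - Λ₁) ∪ f₁⁻¹(roots of the leading coefficient
of `P`)` (`ℂ` is uncountable); then `q(Y) = P(f₁(z₀), Y) ≠ 0` and, by periodicity,
`q(f₂(z₀ + ω)) = 0` for every `ω ∈ Λ₁`, so the `z₀ + ω` lie in finitely many cosets of `Λ₂`; hence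
the image of `Λ₁` in `ℂ/Λ₂` is a finite group, killed by its order `m`. This is the elementary
core of "an algebraic leaf of the diagonal foliation on `E × E′` is an isogeny correspondence"
(Bost 2001, proof of Cor. 2.5, last step; Silverman *AEC* VI.4.1).
[cite: Bost2001AlgebraicLeaves, Cor. 2.5 (proof, p. 173)] -/
theorem exists_pos_nsmul_mem_of_evalEval_eq_zero (hΛ₁ : (Λ₁ : Set ℂ).Countable)
    (hper : ∀ ω ∈ Λ₁, ∀ z, f₁ (z + ω) = f₁ z) (hf₁ : ∀ w, (f₁ ⁻¹' {w}).Countable)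
    (hf₂ : ∀ w, ∃ S : Set ℂ, S.Finite ∧ ∀ z, f₂ z = w → ∃ s ∈ S, z - s ∈ Λ₂)
    {D : Set ℂ} (hD : D.Countable) {P : ℂ[X][Y]} (hP : P ≠ 0)
    (hPz : ∀ z ∉ D, P.evalEval (f₁ z) (f₂ z) = 0) :
    ∃ m : ℕ, 0 < m ∧ ∀ ω ∈ Λ₁, m • ω ∈ Λ₂ := by
  -- Step 1: a generic base point `z₀`.
  set B : Set ℂ := (⋃ ω ∈ (Λ₁ : Set ℂ), (fun z ↦ z + ω) ⁻¹' D) ∪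
    f₁ ⁻¹' {x | P.leadingCoeff.IsRoot x} with hB_def
  have hlc : {x | P.leadingCoeff.IsRoot x}.Finite :=
    Polynomial.finite_setOf_isRoot (leadingCoeff_ne_zero.mpr hP)
  have hB : B.Countable := by
    refine (Set.Countable.biUnion hΛ₁ fun ω _ ↦ ?_).union ?_
    · exact hD.preimage (add_left_injective ω)
    · rw [← Set.biUnion_of_singleton {x | P.leadingCoeff.IsRoot x}, Set.preimage_iUnion₂]
      exact hlc.countable.biUnion fun x _ ↦ hf₁ x
  obtain ⟨z₀, hz₀⟩ : ∃ z₀, z₀ ∉ B := by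
    by_contra h
    push Not at h
    exact not_countable_complex (hB.mono fun z _ ↦ h z)
  have hz₀D : ∀ ω ∈ Λ₁, z₀ + ω ∉ D := fun ω hω h ↦
    hz₀ (Or.inl (Set.mem_biUnion (SetLike.mem_coe.mpr hω) h))
  have hz₀lc : ¬ P.leadingCoeff.IsRoot (f₁ z₀) := fun h ↦ hz₀ (Or.inr h)
  -- Step 2: the specialised polynomial `q(Y) = P(f₁ z₀, Y)` is non-zero.
  set q : ℂ[X] := P.map (evalRingHom (f₁ z₀)) with hq
  have hq0 : q ≠ 0 := by
    intro h0
    apply hz₀lc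
    have h1 : q.coeff P.natDegree = 0 := by rw [h0, coeff_zero]
    rwa [hq, coeff_map, coe_evalRingHom] at h1
  -- Step 3: for `ω ∈ Λ₁`, `f₂ (z₀ + ω)` is a root of `q`.
  have hroot : ∀ ω ∈ Λ₁, q.IsRoot (f₂ (z₀ + ω)) := by
    intro ω hω
    have h1 := hPz _ (hz₀D ω hω)
    rw [hper ω hω] at h1
    rwa [IsRoot, hq, map_evalRingHom_eval]
  -- Step 4: hence the `z₀ + ω`, `ω ∈ Λ₁`, lie in finitely many cosets of `Λ₂`.
  have hR : {y | q.IsRoot y}.Finite := Polynomial.finite_setOf_isRoot hq0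
  choose S hS using hf₂
  set T : Set ℂ := ⋃ y ∈ {y | q.IsRoot y}, S y with hT_def
  have hT : T.Finite := hR.biUnion fun y _ ↦ (hS y).1
  have hcover : ∀ ω ∈ Λ₁, ∃ t ∈ T, z₀ + ω - t ∈ Λ₂ := by
    intro ω hω
    obtain ⟨s, hs, hs'⟩ := (hS (f₂ (z₀ + ω))).2 (z₀ + ω) rfl
    exact ⟨s, Set.mem_biUnion (hroot ω hω) hs, hs'⟩
  -- Step 5: the image of `Λ₁` in `ℂ ⧸ Λ₂` is finite, of order `m`, and `m • Λ₁ ⊆ Λ₂`.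
  set π : ℂ →+ ℂ ⧸ Λ₂ := QuotientAddGroup.mk' Λ₂ with hπ
  set H : AddSubgroup (ℂ ⧸ Λ₂) := Λ₁.map π with hH
  have hHsub : (H : Set (ℂ ⧸ Λ₂)) ⊆ π '' ((fun t ↦ t - z₀) '' T) := by
    rintro x ⟨ω, hω, rfl⟩
    obtain ⟨t, ht, hmem⟩ := hcover ω (SetLike.mem_coe.mp hω)
    refine ⟨t - z₀, ⟨t, ht, rfl⟩, ?_⟩
    rw [hπ, QuotientAddGroup.mk'_apply, QuotientAddGroup.mk'_apply, QuotientAddGroup.eq]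
    convert hmem using 1
    abel
  have hHfin : (H : Set (ℂ ⧸ Λ₂)).Finite := ((hT.image _).image _).subset hHsub
  haveI : Finite H := hHfin.to_subtype
  refine ⟨Nat.card H, Nat.card_pos, fun ω hω ↦ ?_⟩
  have hmem : π ω ∈ H := AddSubgroup.mem_map_of_mem π hω
  have h0 : Nat.card H • (⟨π ω, hmem⟩ : H) = 0 := card_nsmul_eq_zero'
  have h0' : π (Nat.card H • ω) = 0 := by
    rw [map_nsmul]
    exact congrArg Subtype.val h0
  rwa [hπ, QuotientAddGroup.mk'_apply, QuotientAddGroup.eq_zero_iff] at h0'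

end Soft

/-! ### Transfer along a uniformisation `u : ℂ →+ A` with kernel `Λ` -/

section Transfer

variable {A : Type*} [AddCommGroup A] (u : ℂ →+ A) {Λ : AddSubgroup ℂ}

/-- **Fibres modulo the kernel.** If `u : ℂ →+ A` has kernel `Λ` and `g : A → ℂ` has finite
fibres, then each fibre of `g ∘ u` meets only finitely many cosets of `Λ` (one for each point of
the fibre of `g` in the image of `u`). Used with `u` the uniformisation `ℂ → E(ℂ)` by a period
lattice (Silverman *AEC* VI.3.6(b), VI.5.1.1) and `g` a coordinate function on `E(ℂ)`.
[folklore] -/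
theorem exists_finite_fibre_mod_of_ker_eq (hker : u.ker = Λ) (g : A → ℂ)
    (hg : ∀ w, {a | g a = w}.Finite) (w : ℂ) :
    ∃ S : Set ℂ, S.Finite ∧ ∀ z, g (u z) = w → ∃ s ∈ S, z - s ∈ Λ := by
  set S : Set ℂ := ⋃ a ∈ {a | g a = w}, (if h : ∃ z, u z = a then {h.choose} else ∅) with hS
  refine ⟨S, (hg w).biUnion fun a _ ↦ ?_, fun z hz ↦ ?_⟩
  · split_ifs
    · exact Set.finite_singleton _
    · exact Set.finite_empty
  · have hex : ∃ z', u z' = u z := ⟨z, rfl⟩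
    refine ⟨hex.choose, Set.mem_biUnion (show u z ∈ {a | g a = w} from hz) ?_, ?_⟩
    · rw [dif_pos hex]
      exact Set.mem_singleton _
    · rw [← hker, AddMonoidHom.mem_ker, map_sub, hex.choose_spec, sub_self]

/-- **Countable fibres.** If moreover `Λ` is countable, the fibres of `g ∘ u` are countable.
[folklore] -/
theorem countable_preimage_comp_singleton_of_ker_eq (hker : u.ker = Λ)
    (hΛ : (Λ : Set ℂ).Countable) (g : A → ℂ) (hg : ∀ w, {a | g a = w}.Finite) (w : ℂ) :
    ((g ∘ u) ⁻¹' {w}).Countable := by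
  obtain ⟨S, hS, hcov⟩ := exists_finite_fibre_mod_of_ker_eq u hker g hg w
  refine (hS.countable.biUnion fun s _ ↦ hΛ.image fun l ↦ s + l).mono fun z hz ↦ ?_
  obtain ⟨s, hs, hl⟩ := hcov z hz
  exact Set.mem_biUnion hs ⟨z - s, hl, add_sub_cancel s z⟩

/-- **Periodicity.** `g ∘ u` is `Λ`-periodic. [folklore] -/
theorem comp_apply_add_of_ker_eq (hker : u.ker = Λ) (g : A → ℂ) {ω : ℂ} (hω : ω ∈ Λ) (z : ℂ) :
    g (u (z + ω)) = g (u z) := by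
  rw [← hker, AddMonoidHom.mem_ker] at hω
  rw [map_add, hω, add_zero]

end Transfer

end Literature.NumberTheory.EllipticCurves

/-! ### The fibres of `℘_Λ` -/

namespace PeriodPair

variable (L : PeriodPair)

/-- **The fibres of `℘_Λ` are countable**: `℘(z) = ℘(z₁)` with `z, z₁ ∉ Λ` forces `z ≡ ±z₁ (mod Λ)`
(`PeriodPair.weierstrassP_eq_weierstrassP_iff`), and `Λ` itself is countable.
Silverman *AEC* VI.3.6 (`℘` is an even elliptic function of order `2`). [folklore] -/
theorem countable_preimage_weierstrassP_singleton (w : ℂ) : (℘[L] ⁻¹' {w}).Countable := by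
  by_cases h : ∃ z₁ ∉ L.lattice, ℘[L] z₁ = w
  · obtain ⟨z₁, hz₁, rfl⟩ := h
    have hsub : ℘[L] ⁻¹' {℘[L] z₁} ⊆ (L.lattice : Set ℂ) ∪
        ((fun l ↦ -z₁ + l) '' (L.lattice : Set ℂ) ∪ (fun l ↦ z₁ + l) '' (L.lattice : Set ℂ)) := by
      intro z hz
      by_cases hzΛ : z ∈ L.lattice
      · exact Or.inl hzΛ
      · rcases (L.weierstrassP_eq_weierstrassP_iff hzΛ hz₁).mp hz with h1 | h1
        · exact Or.inr (Or.inl ⟨z + z₁, h1, by ring⟩)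
        · exact Or.inr (Or.inr ⟨z - z₁, h1, by ring⟩)
    exact (L.countable_lattice.union
      ((L.countable_lattice.image _).union (L.countable_lattice.image _))).mono hsub
  · push Not at h
    exact L.countable_lattice.mono fun z hz ↦ by_contra fun hzΛ ↦ h z hzΛ hz

/-- **`℘_Λ` has finitely many fibres modulo `Λ`**: every fibre of `℘[L]` meets at most the three
cosets `Λ`, `z₁ + Λ`, `-z₁ + Λ` (Silverman *AEC* VI.3.6; Mathlib's `℘[L]` takes the junk value
`0` on `Λ`). [folklore] -/
theorem exists_finite_weierstrassP_fibre_mod_lattice (w : ℂ) :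
    ∃ S : Set ℂ, S.Finite ∧ ∀ z, ℘[L] z = w → ∃ s ∈ S, z - s ∈ L.lattice.toAddSubgroup := by
  by_cases h : ∃ z₁ ∉ L.lattice, ℘[L] z₁ = w
  · obtain ⟨z₁, hz₁, rfl⟩ := h
    refine ⟨{0, z₁, -z₁}, (Set.toFinite _), fun z hz ↦ ?_⟩
    by_cases hzΛ : z ∈ L.lattice
    · exact ⟨0, by simp, by simpa using hzΛ⟩
    · rcases (L.weierstrassP_eq_weierstrassP_iff hzΛ hz₁).mp hz with h1 | h1
      · exact ⟨-z₁, by simp, by simpa [sub_neg_eq_add] using h1⟩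
      · exact ⟨z₁, by simp, by simpa using h1⟩
  · push Not at h
    refine ⟨{0}, Set.finite_singleton 0, fun z hz ↦ ⟨0, rfl, ?_⟩⟩
    rw [sub_zero, Submodule.mem_toAddSubgroup]
    by_contra hzΛ
    exact h z hzΛ hz

end PeriodPair

/-! ### Finite fibres of the coordinate functions `x` and `t = -x/y` on `E(F)` -/

namespace WeierstrassCurve.Affine.Point

variable {F : Type*} [Field F] (W : WeierstrassCurve F)

/-- **The `x`-coordinate has finite fibres** on the affine points of a Weierstrass curve: the
points with `x = x₀` are the `(x₀, y)` with `y` a root of the (monic, quadratic) Weierstrass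
equation in `y`. Silverman *AEC* III.1, III.2.3. [folklore] -/
theorem finite_setOf_eq_some_X_eq (x₀ : F) :
    {P : W.toAffine.Point | ∃ x y, ∃ h : W.toAffine.Nonsingular x y, P = .some x y h ∧ x = x₀}.Finite := by
  classical
  -- the Weierstrass equation at `x = x₀`, as a polynomial in `y`
  set q : F[X] := X ^ 2 + C (W.a₁ * x₀ + W.a₃) * X -
    C (x₀ ^ 3 + W.a₂ * x₀ ^ 2 + W.a₄ * x₀ + W.a₆) with hq
  have hq0 : q ≠ 0 := by
    have h2 : q.coeff 2 = 1 := by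
      simp only [hq, coeff_sub, coeff_add, coeff_X_pow, coeff_C_mul, coeff_X, coeff_C]
      norm_num
    intro h
    rw [h, coeff_zero] at h2
    exact zero_ne_one h2
  have hroot : ∀ y, W.toAffine.Equation x₀ y → q.IsRoot y := by
    intro y hy
    rw [WeierstrassCurve.Affine.equation_iff] at hy
    simp only [hq, IsRoot.def, eval_sub, eval_add, eval_pow, eval_X, eval_mul, eval_C]
    linear_combination hy
  refine ((Polynomial.finite_setOf_isRoot hq0).image fun y ↦
    if h : W.toAffine.Nonsingular x₀ y then (Point.some x₀ y h : W.toAffine.Point) else 0).subset ?_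
  rintro P ⟨x, y, h, rfl, rfl⟩
  exact ⟨y, hroot y h.left, by simp only [dif_pos h]⟩

/-- **The coordinate `t = -x/y` has finite fibres** on the affine points of a Weierstrass curve
(`t` is the local parameter at `O` of Silverman *AEC* IV.1; with Lean's `x / 0 = 0` the points
with `y = 0` all have `t = 0`): a point with `-x/y = w` has either `y = 0` and `x` a root of the
cubic `x³ + a₂x² + a₄x + a₆`, or `x = -wy` with `y` a root of the non-zero polynomial
`w³Y³ + (1 - a₁w - a₂w²)Y² + (a₃ + a₄w)Y - a₆`. [folklore] -/
theorem finite_setOf_eq_some_negX_div_Y_eq (w : F) :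
    {P : W.toAffine.Point |
      ∃ x y, ∃ h : W.toAffine.Nonsingular x y, P = .some x y h ∧ -x / y = w}.Finite := by
  classical
  -- (i) the points with `y = 0`
  set c : F[X] := X ^ 3 + C W.a₂ * X ^ 2 + C W.a₄ * X + C W.a₆ with hc
  have hc0 : c ≠ 0 := by
    have h3 : c.coeff 3 = 1 := by
      simp only [hc, coeff_add, coeff_X_pow, coeff_C_mul, coeff_X, coeff_C]
      norm_num
    intro h
    rw [h, coeff_zero] at h3
    exact zero_ne_one h3
  have hcroot : ∀ x, W.toAffine.Equation x 0 → c.IsRoot x := by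
    intro x hx
    rw [WeierstrassCurve.Affine.equation_iff] at hx
    simp only [hc, IsRoot.def, eval_add, eval_pow, eval_X, eval_mul, eval_C]
    linear_combination -hx
  -- (ii) the points with `x = -w y`
  set r : F[X] := C (w ^ 3) * X ^ 3 + C (1 - W.a₁ * w - W.a₂ * w ^ 2) * X ^ 2 +
    C (W.a₃ + W.a₄ * w) * X - C W.a₆ with hr
  have hr0 : r ≠ 0 := by
    by_cases hw : w = 0
    · have h2 : r.coeff 2 = 1 := by
        simp only [hr, hw, coeff_sub, coeff_add, coeff_X_pow, coeff_C_mul, coeff_X, coeff_C]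
        norm_num
      intro h
      rw [h, coeff_zero] at h2
      exact zero_ne_one h2
    · have h3 : r.coeff 3 = w ^ 3 := by
        simp only [hr, coeff_sub, coeff_add, coeff_X_pow, coeff_C_mul, coeff_X, coeff_C]
        norm_num
      intro h
      rw [h, coeff_zero] at h3
      exact pow_ne_zero 3 hw h3.symm
  have hrroot : ∀ y, W.toAffine.Equation (-w * y) y → r.IsRoot y := by
    intro y hy
    rw [WeierstrassCurve.Affine.equation_iff] at hy
    simp only [hr, IsRoot.def, eval_sub, eval_add, eval_pow, eval_X, eval_mul, eval_C]
    linear_combination hy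
  refine (((Polynomial.finite_setOf_isRoot hc0).image fun x ↦
      if h : W.toAffine.Nonsingular x 0 then (Point.some x 0 h : W.toAffine.Point) else 0).union
    ((Polynomial.finite_setOf_isRoot hr0).image fun y ↦
      if h : W.toAffine.Nonsingular (-w * y) y then (Point.some (-w * y) y h : W.toAffine.Point) else 0)).subset
    ?_
  rintro P ⟨x, y, h, rfl, hw⟩
  by_cases hy : y = 0
  · subst hy
    exact Or.inl ⟨x, hcroot x h.left, by simp only [dif_pos h]⟩
  · have hx : x = -w * y := by
      rw [← hw]
      field_simp
    subst hx
    exact Or.inr ⟨y, hrroot y h.left, by simp only [dif_pos h]⟩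

end WeierstrassCurve.Affine.Point

/-! ### The theorems -/

namespace Literature.NumberTheory.EllipticCurves

open WeierstrassCurve in
/-- **Elliptic curves over `ℚ` with algebraically dependent uniformised coordinates are
`ℚ`-isogenous** (general coordinates). Let `W₁, W₂` be Weierstrass models over `ℚ` of elliptic
curves with Néron-type period pairs `L₁, L₂`, let `uᵢ : ℂ →+ Wᵢ(ℂ)` be group homomorphisms with
kernel `Λᵢ` (e.g. the uniformisations of `PeriodPair.exists_addMonoidHom_of_g₂_g₃'`, Silverman
*AEC* VI.3.6(b)), and let `gᵢ : Wᵢ(ℂ) → ℂ` be functions with finite fibres (e.g. the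
coordinates `x` or `t = -x/y`, `WeierstrassCurve.Affine.Point.finite_setOf_eq_some_X_eq`,
`…_negX_div_Y_eq`). If a non-zero `P ∈ ℂ[X][Y]` has `P(g₁(u₁ z), g₂(u₂ z)) = 0` for all `z` off a
countable set, then `W₁` and `W₂` are isogenous over `ℚ`. This is the form in which the last step
of Bost's proof of Cor. 2.5 is reached from an algebraicity criterion: the formal leaf
`t₂ = y(t₁)`, `y ∈ ℚ⟦t⟧` algebraic, gives `P(t₁(z), t₂(z)) = 0` for the local parameters
`tᵢ = -xᵢ/yᵢ` along `z ↦ (u₁ z, u₂ z)`. [cite: Bost2001AlgebraicLeaves, Cor. 2.5 (proof, p. 173)] -/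
theorem isIsogenous_of_evalEval_comp_eq_zero {W₁ W₂ : WeierstrassCurve ℚ} [W₁.IsElliptic]
    {L₁ L₂ : PeriodPair} (h₁₂ : L₁.g₂ = (W₁.baseChange ℂ).c₄ / 12)
    (h₁₃ : L₁.g₃ = (W₁.baseChange ℂ).c₆ / 216) (h₂₂ : L₂.g₂ = (W₂.baseChange ℂ).c₄ / 12)
    (h₂₃ : L₂.g₃ = (W₂.baseChange ℂ).c₆ / 216)
    (u₁ : ℂ →+ (W₁.baseChange ℂ).toAffine.Point) (hu₁ : (u₁.ker : Set ℂ) = L₁.lattice)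
    (u₂ : ℂ →+ (W₂.baseChange ℂ).toAffine.Point) (hu₂ : (u₂.ker : Set ℂ) = L₂.lattice)
    (g₁ : (W₁.baseChange ℂ).toAffine.Point → ℂ) (hg₁ : ∀ w, {a | g₁ a = w}.Finite)
    (g₂ : (W₂.baseChange ℂ).toAffine.Point → ℂ) (hg₂ : ∀ w, {a | g₂ a = w}.Finite)
    {P : ℂ[X][Y]} (hP : P ≠ 0) {D : Set ℂ} (hD : D.Countable)
    (hPz : ∀ z ∉ D, P.evalEval (g₁ (u₁ z)) (g₂ (u₂ z)) = 0) : IsIsogenous W₁ W₂ := by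
  have hk₁ : u₁.ker = L₁.lattice.toAddSubgroup :=
    SetLike.coe_injective (hu₁.trans (Submodule.coe_toAddSubgroup _).symm)
  have hk₂ : u₂.ker = L₂.lattice.toAddSubgroup :=
    SetLike.coe_injective (hu₂.trans (Submodule.coe_toAddSubgroup _).symm)
  obtain ⟨m, hm, hle⟩ := exists_pos_nsmul_mem_of_evalEval_eq_zero
    (Λ₁ := L₁.lattice.toAddSubgroup) (Λ₂ := L₂.lattice.toAddSubgroup)
    (f₁ := fun z ↦ g₁ (u₁ z)) (f₂ := fun z ↦ g₂ (u₂ z)) (PeriodPair.countable_lattice L₁)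
    (fun ω hω z ↦ comp_apply_add_of_ker_eq u₁ hk₁ g₁ hω z)
    (countable_preimage_comp_singleton_of_ker_eq u₁ hk₁ (PeriodPair.countable_lattice L₁) g₁ hg₁)
    (exists_finite_fibre_mod_of_ker_eq u₂ hk₂ g₂ hg₂) hD hP hPz
  refine isIsogenous_of_forall_mul_mem_lattice h₁₂ h₁₃ h₂₂ h₂₃ (c := (m : ℚ))
    (by exact_mod_cast hm.ne') fun z hz ↦ ?_
  have h1 := hle z hz
  rw [Submodule.mem_toAddSubgroup, nsmul_eq_mul] at h1
  exact_mod_cast h1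

open WeierstrassCurve in
/-- **Elliptic curves over `ℚ` with algebraically dependent Weierstrass functions are
`ℚ`-isogenous** — the last step of Bost's proof of Faltings' Korollar 2 over `ℚ` (Bost 2001,
Cor. 2.5: "if `h` is algebraic, the algebraic subgroup `H` of `E × E′` such that `h = Lie H` is
`ℚ`-isogenous both to `E` and `E′`"), in analytic dress. Let `W₁, W₂` be Weierstrass models over
`ℚ` of elliptic curves and `L₁, L₂` period pairs of Néron type for them (`g₂ = c₄/12`,
`g₃ = c₆/216`: the period lattices of the invariant differentials). If some non-zero
`P ∈ ℂ[X][Y]` satisfies `P(℘[L₁](z), ℘[L₂](z)) = 0` for all `z` off a countable set, then `W₁`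
and `W₂` are isogenous over `ℚ`: by `exists_pos_nsmul_mem_of_evalEval_eq_zero` some `m > 0` has
`mΛ₁ ⊆ Λ₂`, and multiplication by the rational number `m` is then an isogeny defined over `ℚ`
(`isIsogenous_of_forall_mul_mem_lattice`, Silverman *AEC* VI.4.1 and VI.5.3).
[cite: Bost2001AlgebraicLeaves, Cor. 2.5 (proof, p. 173)] -/
theorem isIsogenous_of_evalEval_weierstrassP_eq_zero {W₁ W₂ : WeierstrassCurve ℚ} [W₁.IsElliptic]
    {L₁ L₂ : PeriodPair} (h₁₂ : L₁.g₂ = (W₁.baseChange ℂ).c₄ / 12)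
    (h₁₃ : L₁.g₃ = (W₁.baseChange ℂ).c₆ / 216) (h₂₂ : L₂.g₂ = (W₂.baseChange ℂ).c₄ / 12)
    (h₂₃ : L₂.g₃ = (W₂.baseChange ℂ).c₆ / 216) {P : ℂ[X][Y]} (hP : P ≠ 0) {D : Set ℂ}
    (hD : D.Countable) (hPz : ∀ z ∉ D, P.evalEval (℘[L₁] z) (℘[L₂] z) = 0) :
    IsIsogenous W₁ W₂ := by
  obtain ⟨m, hm, hle⟩ := exists_pos_nsmul_mem_of_evalEval_eq_zero
    (Λ₁ := L₁.lattice.toAddSubgroup) (Λ₂ := L₂.lattice.toAddSubgroup) (f₁ := ℘[L₁]) (f₂ := ℘[L₂])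
    (PeriodPair.countable_lattice L₁)
    (fun ω hω z ↦ L₁.weierstrassP_add_coe z ⟨ω, hω⟩)
    (PeriodPair.countable_preimage_weierstrassP_singleton L₁)
    (PeriodPair.exists_finite_weierstrassP_fibre_mod_lattice L₂) hD hP hPz
  refine isIsogenous_of_forall_mul_mem_lattice h₁₂ h₁₃ h₂₂ h₂₃ (c := (m : ℚ))
    (by exact_mod_cast hm.ne') fun z hz ↦ ?_
  have h1 := hle z hz
  rw [Submodule.mem_toAddSubgroup, nsmul_eq_mul] at h1
  exact_mod_cast h1

end Literature.NumberTheory.EllipticCurves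

end
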